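import Literature.AnabelianGeometry.EtaleTheta.ArithThetaTowerThetaRestBirat
import HarnessLib

/-!
# [IUTchI] Ex. 3.2 (ii)/(v) at the ARITHMETIC theta tower: `Θ̲_v` is not a constant of valuation zero —
# `𝒪^×_{K_v} × Θ̲_v^ℤ ↪ 𝒪^×(T^÷_{Ÿ_v})` (GAP A item GA-06, add-on file 5 — PROOF-ONLY)

S. Mochizuki, *Inter-universal Teichmüller Theory I* [Mochizuki2012], Ex. 3.2 (ii) p.70 («`Θ̲_v ∈ 𝒪^×(T^÷_{Ÿ_v})`»), (v) p.72
(«`𝒪^×_{𝒞^Θ_v}(−) · Θ̲_v^ℕ`», the image of `𝒪^⊳_{𝒞⊢_v} = 𝒪^× · q̲_v^ℕ` under «`q̲_v ↦ Θ̲_v`») [claim: Mochizuki2012, status: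
disputed] (D-0012 claim key; elementary LEMMAS over OUR typed objects, nothing of the series asserted); S. Mochizuki, *The
geometry of Frobenioids I* [MochizukiFrdI2008], Prop. 4.4 (i) p.84 (the divisor homomorphism `𝒪^×(A^birat) → Φ^gp(A)`), Thm. 5.2
(ii) p.101 («Moreover» `B(A) ≃ 𝒪^×(T^÷_A)` with divisors), Def. 1.1 (i) p.19 (divisorial monoids: `Φ^gp` torsion-free);
*The geometry of Frobenioids II* [MochizukiFrdII2008], Ex. 1.1 (i) p.7 (`K^× → ord(𝒪_K^⊳)^gp` kills exactly `𝒪_K^×`).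
GAP A of record G-L5-EX32I-1, item GA-06 (D6 FIELDS half; ruled shape `plan/L5/GAP-A-SIGNATURES.md` v1 §5, RULINGS #341 (B));
this add-on answers the acceptance critic's OPTIONAL item (β) of 2026-08-28T21:46:37Z («`theta_ne_constUnits (u) :
theta hC hF ≠ constUnits hC hF u`») OVER THE BINDERS `(hC : CarrierSpec d T C) (hF)` — never over the term.

WHAT IS HERE (all over the spec binders; the four GA-06 files ★ p669815 · p671230 · p671807 · p672481 are untouched):
* §1 `𝒪^×_{K_v} → (Ω^{G_v})^×` preserves «valuation `= 1`» (`ValuativeExtension K_v Ω` + the restricted relation `valOn` of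
  the field functor), so the [FrdII] Ex. 1.1 divisor map `divUnits` KILLS `intUnitsToYdd u` (`PadicFrd.ker_divUnits`).
* §2 hence the birational divisor of every constant `constUnits hC hF u`, `u ∈ 𝒪^×_{K_v}`, is TRIVIAL (`divHom_constUnits`
  ★ p669815 :389 reads it as that valuation), while the birational divisor `[Z] − [Pl]` of `Θ̲_v = theta hC hF` is NON-TRIVIAL
  (GA-16's `divHom_theta_ne_one` ★ p673137 :211 — S0's `theta` clause: `Z` cuspidal `≠ 0`, `Pl` non-cuspidal) and `Φ(Ÿ_T)^gp`
  is torsion-free (`gp_eq_one_of_pow_eq_one` ★ p673137 :180): **`theta_ne_constUnits`**, `theta_pow_ne_constUnits`,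
  `theta_zpow_ne_constUnits`, `disjoint_zpowers_theta_range_constUnits`, and the injectivity of
  `(u, n) ↦ constUnits u · Θ̲^n` on `𝒪^×_{K_v} × ℤ` — the monoid `𝒪^× · Θ̲_v^ℕ` of Ex. 3.2 (v) is `𝒪^× × ℕ` on the nose.
* §3 the same read at GA-16's D6 def of record `thetaRestBirat_of_carrierSpec hC hF hq l` (fields BY NAME, ★ p673462) and at its
  kit image `toRest` (`Θ̲_v ∈ Aut(T^÷_{Ÿ_v})` is none of the constant automorphisms; [FrdI] Prop. 4.4 (iv) `toAut` injective).
Why this IS derivable from the decoupling spec S0 alone (the gen-0 HANDOFF said «not derivable from `CarrierSpec` alone»,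
which is right for CONSTANTS `K_v^×` — S0 does not type their divisors as non-cuspidal — but not for UNITS): a unit of `𝒪_{K_v}`
has valuation `1`, so its divisor vanishes whatever S0 says about constants' divisors; only `Div Θ̲_v ≠ 0` is needed of S0.
carrier: none defined here (#322 (c3′): the carrier is the one `hC` specifies; GUARD and the finite-avatar label of `l·ℤ` as in
★ p669815).  HONEST FRAMING: PROOF-ONLY lemmas at OUR typed objects over a `Prop`-valued spec; typed ≠ inhabited (the term is
GA-12's) ≠ proved-in-print; an UNDISPUTED construction around [IUTchIII] Cor. 3.12, which stays OPEN by charter (D-0045) — no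
side taken on it or on any author; nothing here asserts abc proved or refuted; count-neutral (no row, no token).
No def, no instance, no notation, no `sorry`.
-/

namespace Literature.AnabelianGeometry.EtaleTheta

namespace ArithThetaTower

open CategoryTheory Opposite Function Literature.AlgebraicGeometry.Frobenioids Literature.AnabelianGeometry.SemiGraphs
  Literature.IUT.HodgeTheaters Literature.AlgebraicGeometry.Frobenioids.PadicFrd

/-! ## §1 Units of `𝒪_{K_v}` keep valuation `1` in `Ω^{G_v}`; their [FrdII] divisor vanishes -/

section IntUnits

variable {p : ℕ} [Fact p.Prime] (d : GaloisValDatum.{0} p) {P : Type} [Group P] [TopologicalSpace P]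
  (T : BadLocalGroupDatum d.Gal P)

/-- A unit `u ∈ 𝒪^×_{K_v}` keeps valuation `1` in the base field `Ω^{aug Ÿ_T} = Ω^{G_v}` of `Ÿ_T` (the valuative relation
of `Ω` extends that of `K_v`, and the field functor carries the restricted relation). [cite: MochizukiFrdII2008, Ex 1.1 (i) p.7] -/
theorem valuation_coe_intUnitsToYdd (u : (intNonzero d.k)ˣ) :
    ValuativeRel.valuation (d.fieldFunctor.obj (T.proj.obj T.ydd)).K
      ((intUnitsToYdd (d := d) (T := T) u : ((d.fieldFunctor.obj (T.proj.obj T.ydd)).K)ˣ) :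
        (d.fieldFunctor.obj (T.proj.obj T.ydd)).K) = 1 := by
  have hu : ValuativeRel.valuation d.k ((u : intNonzero d.k) : d.k) = 1 :=
    (isUnit_intNonzero_iff d.k (u : intNonzero d.k)).mp u.isUnit
  have hΩ : ValuativeRel.valuation d.Ω (algebraMap d.k d.Ω ((u : intNonzero d.k) : d.k)) = 1 := by
    apply le_antisymm
    · rw [← (ValuativeRel.valuation d.Ω).map_one, ← Valuation.Compatible.vle_iff_le, ← (algebraMap d.k d.Ω).map_one,
        ValuativeExtension.vle_iff_vle, Valuation.Compatible.vle_iff_le (v := ValuativeRel.valuation d.k), map_one, hu]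
    · rw [← (ValuativeRel.valuation d.Ω).map_one, ← Valuation.Compatible.vle_iff_le, ← (algebraMap d.k d.Ω).map_one,
        ValuativeExtension.vle_iff_vle, Valuation.Compatible.vle_iff_le (v := ValuativeRel.valuation d.k), map_one, hu]
  change @ValuativeRel.valuation (d.fixedFld (T.proj.obj T.ydd)) _ (d.valOn (d.fixedFld (T.proj.obj T.ydd)))
      (algebraMap d.k (d.fixedFld (T.proj.obj T.ydd)) ((u : intNonzero d.k) : d.k)) = 1
  letI := d.valOn (d.fixedFld (T.proj.obj T.ydd))
  rw [le_antisymm_iff, ← (ValuativeRel.valuation (d.fixedFld (T.proj.obj T.ydd))).map_one,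
    ← Valuation.Compatible.vle_iff_le, ← Valuation.Compatible.vle_iff_le, d.valOn_iff, d.valOn_iff, OneMemClass.coe_one]
  change algebraMap d.k d.Ω ((u : intNonzero d.k) : d.k) ≤ᵥ 1 ∧ 1 ≤ᵥ algebraMap d.k d.Ω ((u : intNonzero d.k) : d.k)
  rw [Valuation.Compatible.vle_iff_le (v := ValuativeRel.valuation d.Ω),
    Valuation.Compatible.vle_iff_le (v := ValuativeRel.valuation d.Ω), map_one, hΩ]
  exact ⟨le_rfl, le_rfl⟩

/-- `𝒪^×_{K_v} → (Ω^{G_v})^×` lands in `𝒪^×_{Ω^{G_v}}` (valuation `1`). [cite: MochizukiFrdII2008, Ex 1.1 (i) p.7] -/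
theorem intUnitsToYdd_mem_unitSubgroup (u : (intNonzero d.k)ˣ) :
    intUnitsToYdd (d := d) (T := T) u ∈ unitSubgroup (d.fieldFunctor.obj (T.proj.obj T.ydd)).K :=
  valuation_coe_intUnitsToYdd d T u

/-- The [FrdII] Ex. 1.1 divisor map `K^× → ord(𝒪_K^⊳)^gp` KILLS the units of `𝒪_{K_v}` read in `Ω^{G_v}` (`ker = 𝒪^×`).
[cite: MochizukiFrdII2008, Ex 1.1 (i) p.7] -/
theorem divUnits_intUnitsToYdd (u : (intNonzero d.k)ˣ) :
    divUnits (d.fieldFunctor.obj (T.proj.obj T.ydd)).K (intUnitsToYdd (d := d) (T := T) u) = 1 := by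
  rw [← MonoidHom.mem_ker, ker_divUnits]
  exact intUnitsToYdd_mem_unitSubgroup d T u

end IntUnits

/-! ## §2 `Θ̲_v` versus the constants `𝒪^×_{K_v}` in `𝒪^×(T^÷_{Ÿ_v})` -/

section ThetaNotConst

variable {p : ℕ} [Fact p.Prime] {d : GaloisValDatum.{0} p} {P : Type} [Group P] [TopologicalSpace P]
  {T : BadLocalGroupDatum d.Gal P}
  {T' : RealifiedDivisorMonoids (D₀ := T.Dv) treeMonoidVocabWeak.{0}} {VD : FrdICatStub.{0, 0, 0} T.Dv}
  {C : TemperedFrobenioid T' T.Dv VD}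

/-- **Constants of valuation zero have TRIVIAL birational divisor**: `Div(constUnits u) = 0` in `Φ(Ÿ_T)^gp` for every
`u ∈ 𝒪^×_{K_v}` ([FrdI] Prop. 4.4 (i) divisor homomorphism; Thm. 5.2 (ii) reads it as the valuation of `u`, which is `0`).
[cite: MochizukiFrdI2008, Thm. 5.2 (ii) p.101] -/
theorem divHom_constUnits_eq_one (hC : CarrierSpec d T C) (hF : PreFrobenioid.IsFrobenioid C.toElem) (u : (intNonzero d.k)ˣ) :
    PreFrobenioid.BiratUnits.divHom hF (⟨T.ydd, 1⟩ : C.category) (constUnits hC hF u) = 1 := by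
  rw [divHom_constUnits, divUnits_intUnitsToYdd, map_one, map_one]
  rfl

/-- The constants `𝒪^×_{K_v} → 𝒪^×(T^÷_{Ÿ_v})` land in the kernel of the divisor homomorphism `𝒪^×(T^÷_{Ÿ_v}) → Φ(Ÿ_T)^gp`.
[cite: MochizukiFrdI2008, Prop. 4.4 (i) p.84] -/
theorem range_constUnits_le_ker_divHom (hC : CarrierSpec d T C) (hF : PreFrobenioid.IsFrobenioid C.toElem) :
    (constUnits hC hF).range ≤ (PreFrobenioid.BiratUnits.divHom hF (⟨T.ydd, 1⟩ : C.category)).ker := by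
  rintro _ ⟨u, rfl⟩
  exact divHom_constUnits_eq_one hC hF u

/-- **`Θ̲_v ≠ 1`**: the theta unit is a non-trivial birational unit (its divisor `[Z] − [Pl]` is non-zero).
([IUTchI] Ex 3.2 (ii) p.70) [claim: Mochizuki2012, status: disputed] -/
theorem theta_ne_one (hC : CarrierSpec d T C) (hF : PreFrobenioid.IsFrobenioid C.toElem) : theta hC hF ≠ 1 :=
  fun h => divHom_theta_ne_one hC hF (by rw [h, map_one])

/-- **`Θ̲_v` is NOT a constant of valuation zero**: `theta hC hF ≠ constUnits hC hF u` for every `u ∈ 𝒪^×_{K_v}` — the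
birational divisors differ (`[Z] − [Pl] ≠ 0 = Div(u)`).  The acceptance critic's optional distinguishing item (β), over the
spec binders. ([IUTchI] Ex 3.2 (v) p.72) [claim: Mochizuki2012, status: disputed] -/
theorem theta_ne_constUnits (hC : CarrierSpec d T C) (hF : PreFrobenioid.IsFrobenioid C.toElem) (u : (intNonzero d.k)ˣ) :
    theta hC hF ≠ constUnits hC hF u :=
  fun h => divHom_theta_ne_one hC hF (by rw [h, divHom_constUnits_eq_one])

/-- **No positive power of `Θ̲_v` is a constant of valuation zero** (`n · ([Z] − [Pl]) ≠ 0`: `Φ(Ÿ_T)^gp` is torsion-free,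
[FrdI] Def. 1.1 (i)). ([IUTchI] Ex 3.2 (v) p.72) [claim: Mochizuki2012, status: disputed] -/
theorem theta_pow_ne_constUnits (hC : CarrierSpec d T C) (hF : PreFrobenioid.IsFrobenioid C.toElem) {n : ℕ} (hn : n ≠ 0)
    (u : (intNonzero d.k)ˣ) : theta hC hF ^ n ≠ constUnits hC hF u := by
  intro h
  have hx : PreFrobenioid.BiratUnits.divHom hF (⟨T.ydd, 1⟩ : C.category) (theta hC hF) ^ n = 1 := by
    rw [← map_pow, h, divHom_constUnits_eq_one]
  exact divHom_theta_ne_one hC hF (gp_eq_one_of_pow_eq_one hF (op T.ydd) (Nat.pos_of_ne_zero hn) hx)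

/-- **No non-zero integral power of `Θ̲_v` is a constant of valuation zero.** ([IUTchI] Ex 3.2 (v) p.72)
[claim: Mochizuki2012, status: disputed] -/
theorem theta_zpow_ne_constUnits (hC : CarrierSpec d T C) (hF : PreFrobenioid.IsFrobenioid C.toElem) {n : ℤ} (hn : n ≠ 0)
    (u : (intNonzero d.k)ˣ) : theta hC hF ^ n ≠ constUnits hC hF u := by
  obtain ⟨m, rfl | rfl⟩ := Int.eq_nat_or_neg n
  · rw [zpow_natCast]
    exact theta_pow_ne_constUnits hC hF (n := m) (fun hm => hn (by rw [hm, Nat.cast_zero])) u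
  · rw [zpow_neg, zpow_natCast]
    intro h
    apply theta_pow_ne_constUnits hC hF (n := m) (fun hm => hn (by rw [hm, Nat.cast_zero, neg_zero])) u⁻¹
    rw [map_inv, ← h, inv_inv]

/-- **`Θ̲_v^ℤ ∩ 𝒪^×_{K_v} = 1` in `𝒪^×(T^÷_{Ÿ_v})`.** ([IUTchI] Ex 3.2 (v) p.72) [claim: Mochizuki2012, status: disputed] -/
theorem disjoint_zpowers_theta_range_constUnits (hC : CarrierSpec d T C) (hF : PreFrobenioid.IsFrobenioid C.toElem) :
    Disjoint (Subgroup.zpowers (theta hC hF)) (constUnits hC hF).range := by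
  rw [Subgroup.disjoint_def]
  intro x hx hu
  obtain ⟨n, rfl⟩ := Subgroup.mem_zpowers_iff.mp hx
  obtain ⟨u, hu⟩ := hu
  by_cases hn : n = 0
  · rw [hn, zpow_zero]
  · exact (theta_zpow_ne_constUnits hC hF hn u hu.symm).elim

/-- **`𝒪^×_{K_v} × Θ̲_v^ℤ ↪ 𝒪^×(T^÷_{Ÿ_v})`**: `(u, n) ↦ constUnits u · Θ̲_v^n` is injective — the exponent is read off the
birational divisor (`Div = n · ([Z] − [Pl])`, torsion-free), then the constant by `constUnits_injective` (genuine constants).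
So the monoid «`𝒪^× · Θ̲_v^ℕ`» of Ex. 3.2 (v) is `𝒪^×_{K_v} × ℕ` on the nose, the shape `q̲_v ↦ Θ̲_v` transports
`𝒪^⊳_{𝒞⊢_v} = 𝒪^× · q̲_v^ℕ` onto. ([IUTchI] Ex 3.2 (v) p.72) [claim: Mochizuki2012, status: disputed] -/
theorem constUnits_mul_theta_zpow_injective (hC : CarrierSpec d T C) (hF : PreFrobenioid.IsFrobenioid C.toElem) :
    Injective (fun x : (intNonzero d.k)ˣ × ℤ => constUnits hC hF x.1 * theta hC hF ^ x.2) := by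
  rintro ⟨u, m⟩ ⟨v, n⟩ h
  dsimp only at h
  have hmn : m = n := by
    by_contra hne
    have h1 : theta hC hF ^ m = (constUnits hC hF u)⁻¹ * (constUnits hC hF v * theta hC hF ^ n) :=
      eq_inv_mul_of_mul_eq h
    have key : theta hC hF ^ (m - n) = constUnits hC hF (u⁻¹ * v) := by
      rw [zpow_sub, map_mul, map_inv, h1, ← mul_assoc, mul_inv_cancel_right]
    exact theta_zpow_ne_constUnits hC hF (sub_ne_zero.mpr hne) _ key
  subst hmn
  exact Prod.ext (constUnits_injective hC hF (mul_right_cancel h)) rfl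

end ThetaNotConst

/-! ## §3 The same at the D6 def of record `thetaRestBirat_of_carrierSpec` (GA-16 ★ p673462) and at its kit image `toRest` -/

section DefOfRecord

variable {p : ℕ} [Fact p.Prime] {d : GaloisValDatum.{0} p} {P : Type} [Group P] [TopologicalSpace P]
  {T : BadLocalGroupDatum d.Gal P}
  {T' : RealifiedDivisorMonoids (D₀ := T.Dv) treeMonoidVocabWeak.{0}} {VD : FrdICatStub.{0, 0, 0} T.Dv}
  {C : TemperedFrobenioid T' T.Dv VD}

/-- At the assembled rest input of record: its `Θ̲_v` field is none of its constants `𝒪^×_{K_v} → 𝒪^×(T^÷_{Ÿ_v})`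
(fields read BY NAME: `thetaRestBirat_of_carrierSpec_theta/_constUnits`). ([IUTchI] Ex 3.2 (v) p.72)
[claim: Mochizuki2012, status: disputed] -/
theorem thetaRestBirat_of_carrierSpec_theta_ne_constUnits (hC : CarrierSpec d T C)
    (hF : PreFrobenioid.IsFrobenioid C.toElem) {qroot : intNonzero d.k} (hq : ¬ IsUnit qroot) (l : ℕ)
    (u : (intNonzero d.k)ˣ) :
    (thetaRestBirat_of_carrierSpec hC hF hq l).theta ≠ (thetaRestBirat_of_carrierSpec hC hF hq l).constUnits u :=
  theta_ne_constUnits hC hF u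

/-- At the assembled rest input of record: no non-zero integral power of its `Θ̲_v` field is one of its constants.
([IUTchI] Ex 3.2 (v) p.72) [claim: Mochizuki2012, status: disputed] -/
theorem thetaRestBirat_of_carrierSpec_theta_zpow_ne_constUnits (hC : CarrierSpec d T C)
    (hF : PreFrobenioid.IsFrobenioid C.toElem) {qroot : intNonzero d.k} (hq : ¬ IsUnit qroot) (l : ℕ) {n : ℤ} (hn : n ≠ 0)
    (u : (intNonzero d.k)ˣ) :
    (thetaRestBirat_of_carrierSpec hC hF hq l).theta ^ n ≠ (thetaRestBirat_of_carrierSpec hC hF hq l).constUnits u :=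
  theta_zpow_ne_constUnits hC hF hn u

/-- At the kit image `toRest` (abc-iut-L5-t2's `TemperedThetaRest`: `Θ̲_v := toAut Θ̲_v ∈ Aut(T^÷_{Ÿ_v})`, constants through
`𝒪^×(T^÷_{Ÿ_v}) ↪ Aut(T^÷_{Ÿ_v})`, [FrdI] Prop. 4.4 (iv) `toAut` injective): the automorphism `Θ̲_v` of `T^÷_{Ÿ_v}` is none
of the constant automorphisms. ([IUTchI] Ex 3.2 (ii) p.70) [claim: Mochizuki2012, status: disputed] -/
theorem thetaRestBirat_of_carrierSpec_toRest_theta_ne_constUnits (hC : CarrierSpec d T C)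
    (hF : PreFrobenioid.IsFrobenioid C.toElem) {qroot : intNonzero d.k} (hq : ¬ IsUnit qroot) (l : ℕ)
    (u : (intNonzero d.k)ˣ) :
    (thetaRestBirat_of_carrierSpec hC hF hq l).toRest.theta ≠
      ↑((thetaRestBirat_of_carrierSpec hC hF hq l).toRest.constUnits u) := by
  intro h
  have h' : PreFrobenioid.BiratUnits.toAut (PreFrobenioid.hasBiratSquares_of_isFrobenioid hF) (theta hC hF) =
      PreFrobenioid.BiratUnits.toAut (PreFrobenioid.hasBiratSquares_of_isFrobenioid hF) (constUnits hC hF u) := h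
  exact theta_ne_constUnits hC hF u (PreFrobenioid.BiratUnits.toAut_injective h')

end DefOfRecord

end ArithThetaTower

end Literature.AnabelianGeometry.EtaleTheta
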